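import Summits.RiemannHypothesis.RiemannHypothesis.Theorems.PfPersistenceGalerkinNesting
import Summits.RiemannHypothesis.RiemannHypothesis.Theorems.PfPersistenceGalerkinMarkovAtCutoff
import Summits.RiemannHypothesis.RiemannHypothesis.Theorems.GroundBartaPolarPerronFrobeniusAeNonnegOfL2Limit
import Summits.RiemannHypothesis.RiemannHypothesis.Theorems.GroundBartaPolarPerronFrobeniusCruxBridge
import Literature.NumberTheory.LFunctions.WeilSemilocalCompactnessProofs
import HarnessLib

/-!
# PF persistence — GAL-2 part B: one-signed Galerkin bottom vectors at unboundedly many truncations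
# give a ONE-SIGNED CONTINUUM EVEN GROUND STATE (pub-rhpf, cand-3 gen 8; CASE-DAG §6 GAL-2)

**HONEST FRAMING. This is a long-odds MECHANISM / RIGIDITY campaign; no RH claims.** This file is RH-free
except for the last, explicitly CONDITIONAL corollary (label E1: an implication whose hypothesis is a
`ζ`-specific law over ALL half-lengths — it credits nothing and asserts nothing about `ζ`). Labels: every
statement is PROVED; no DATA enters.

THE THEOREM (`exists_oneSigned_evenGroundState_of_frequently_oneSignedAt`). Fix a half-length `a > 0`.
If for infinitely many truncation ranks `N` the even block of `ζ`'s truncated Weil form at `(a, N)` has a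
bottom vector whose cosine profile `θ_u` is one-signed on `[-a, a]` (the served field
`theta_sign_changes_even = 0`, i.e. `zetaDatum ∈ oneSignedAt ⟨a, N, ha⟩`), then the continuum even sector
at `a` has a ground state (`IsWeilEvenGroundState a u`, CCM25 Thm 6.1 (iii) shape) that is real and
nonnegative a.e. on `(-a, a)` — exactly the per-window clause of the crux `EvenOneSignedWindows` of the
route `EvenSectorBarta`. This is the tree form of the cell's G1.IMP reading "M1_fin ⇒ T1" at one
half-length (RULING A0 (iv): previously HEURISTIC), now a theorem; it needs NO simplicity of the bottom
eigenvalue and NO rate.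

PROOF (all inputs PROVED in the tree). (1) SIGN-CARRYING DENSITY (`exists_nonneg_test_near_cutoffProfile`):
barrier-prover's truncate-then-mollify construction (`cutoffProfileFormDensity`: `g = (1_{[-b,b]} θ_v) ⋆ φ_k`)
is re-run keeping track of the sign — the bump mollifier is real nonnegative, so a nonnegative profile
gives a nonnegative smooth even test in the window, close to the cut-off profile in mass AND in `Re Q`.
(2) At a one-signed truncation, normalise the bottom vector (flip its sign if needed), read
`vᵀ(ζ-block)v = Re Q(cut-off profile)` and `vᵀv = ‖cut-off profile‖²` (cand-3/barrier-prover
`galerkinMatrixIdentity`), and normalise the test in `L²` (`exists_normalised_of_nonneg_test`): a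
nonnegative normalised even test with `Re Q` within `δ` of `ε₁^{(N)}(a)` up to the mass correction.
(3) Along the one-signed truncations `ε₁^{(N)}(a) → ε_ev(a)` (part A,
`tendsto_bottomRayleigh_comp_strictMono`), so these tests form an even MINIMISING sequence; CCM25 Thm 3.6
(`ConnesConsaniMoscovici2025_thm_3_6_holds`, PROVED in Literature) extracts an `L²`-convergent subsequence,
whose limit is an even ground state (`IsWeilEvenGroundState.of_tendsto`) and inherits the sign a.e.
(`PolarPerronFrobenius.stub_aeNonneg_of_L2_limit`).

COROLLARIES. `evenOneSignedWindows_of_cofinal_frequently_oneSignedAt`: one-signed served bottom vectors at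
infinitely many truncations for UNBOUNDEDLY MANY half-lengths ⇒ `EvenOneSignedWindows` (RH-free
implication); `riemannHypothesis_of_cofinal_frequently_oneSignedAt` [E1, CONDITIONAL]: the same hypothesis
⇒ RH, by the landed `PolarPerronFrobenius.riemannHypothesis_of_evenOneSignedWindows`. What this does NOT
say: nothing asserts the hypothesis for `ζ` (the served `theta_sign_changes_even = 0` cells are DATA at
finitely many `(λ, N)` and can never discharge an "infinitely many `N`" clause — locality barrier).
-/

set_option linter.dupNamespace false  -- the mandated namespace repeats `RiemannHypothesis`

noncomputable section

open Complex Filter Set MeasureTheory Topology Matrix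
open scoped Real ComplexConjugate

namespace Summit.RiemannHypothesis.RiemannHypothesis.Theorems.PfPersistence

open Literature.NumberTheory.LFunctions Literature.NumberTheory.LFunctions.WeilContinuous

/-! ## §1 Sign-carrying density: nonnegative profiles have nonnegative smooth approximants in the window -/

/-- PROVED: mollifying a REAL NONNEGATIVE function by the bump mollifier `φ_k` (real, nonnegative) gives a
real nonnegative function. [folklore] -/
theorem weilConv_moll_real_nonneg {F : ℝ → ℂ} (hF : ∀ u, (F u).im = 0 ∧ 0 ≤ (F u).re) (k : ℕ) (t : ℝ) :
    (weilConv F (moll k) t).im = 0 ∧ 0 ≤ (weilConv F (moll k) t).re := by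
  have hint : (fun u ↦ F u * moll k (t - u)) =
      fun u ↦ (((F u).re * (bump k).normed volume (t - u) : ℝ) : ℂ) := by
    funext u
    apply Complex.ext
    · simp [Complex.mul_re, moll, (hF u).1]
    · simp [Complex.mul_im, moll, (hF u).1]
  rw [weilConv_apply, hint, integral_complex_ofReal]
  refine ⟨Complex.ofReal_im _, ?_⟩
  rw [Complex.ofReal_re]
  exact integral_nonneg fun u ↦ mul_nonneg (hF u).2 ((bump k).nonneg_normed _)

/-- **PROVED — SIGN-CARRYING `C_c^∞`-DENSITY FOR CUT-OFF COSINE PROFILES.** If the profile `θ_v` is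
nonnegative on the window `[-a, a]`, then for every `δ > 0` there is a smooth compactly supported EVEN test
`g`, supported in `[-a, a]`, REAL AND NONNEGATIVE pointwise, whose `L²` mass and whose `Re Q(g)` are within
`δ` of those of the cut-off profile `1_{[-a,a]} θ_v`. The construction is barrier-prover's
(`cutoffProfileFormDensity`, truncate at `b_n = a - a/(n+2)` then mollify by `φ_k`); the new clause is the
sign, from `weilConv_moll_real_nonneg`. RH-free. [folklore] -/
theorem exists_nonneg_test_near_cutoffProfile (win : Window) (v : Fin (win.N + 1) → ℝ)
    (hv : ∀ x ∈ Icc (-win.a) win.a, 0 ≤ profile (2 * win.a) v x) {δ : ℝ} (hδ : 0 < δ) :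
    ∃ g : ℝ → ℂ, IsWeilTest g ∧ tsupport g ⊆ Icc (-win.a) win.a ∧ (∀ t, g (-t) = g t) ∧
      (∀ t, (g t).im = 0 ∧ 0 ≤ (g t).re) ∧
      |(∫ t, ‖g t‖ ^ 2) - ∫ t, ‖cutoffProfile win v t‖ ^ 2| ≤ δ ∧
      |(weilQuadratic g).re - (weilQuadratic (cutoffProfile win v)).re| ≤ δ := by
  have ha : 0 < win.a := win.ha
  set θ : ℝ → ℂ := profileC (2 * win.a) v with hθ
  have hθd : ∀ x, HasDerivAt θ (((deriv (fun y ↦ profile (2 * win.a) v y) x : ℝ) : ℂ)) x :=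
    hasDerivAt_profileC _ v
  have hθ' : Continuous fun x ↦ ((deriv (fun y ↦ profile (2 * win.a) v y) x : ℝ) : ℂ) :=
    continuous_deriv_profileC _ v
  have hθc : Continuous θ := continuous_profileC _ v
  have hG : cutoffProfile win v = cutoffAt win.a θ := cutoffProfile_eq_indicator win v
  -- STEP 1: the radius
  obtain ⟨hW, hM⟩ := tendsto_form_and_mass_cutoffAt hθd hθ' (b := radiusSeq win.a) (B := win.a)
    (fun n ↦ radiusSeq_mem ha.le n) ⟨ha.le, le_rfl⟩ (tendsto_radiusSeq win.a)
  have h1 : ∀ᶠ n in atTop, dist (weilFunctional (autocorrAt (radiusSeq win.a n) θ))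
      (weilFunctional (autocorrAt win.a θ)) < δ / 2 := Metric.tendsto_nhds.1 hW _ (by positivity)
  have h2 : ∀ᶠ n in atTop, dist (∫ t, ‖cutoffAt (radiusSeq win.a n) θ t‖ ^ 2)
      (∫ t, ‖cutoffAt win.a θ t‖ ^ 2) < δ / 2 := Metric.tendsto_nhds.1 hM _ (by positivity)
  obtain ⟨n, hn1, hn2⟩ := (h1.and h2).exists
  have hb0 : 0 < radiusSeq win.a n := radiusSeq_pos ha n
  have hba : radiusSeq win.a n < win.a := radiusSeq_lt ha n
  set b : ℝ := radiusSeq win.a n with hb_def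
  -- STEP 2: the rough function `F = F_b`; it is REAL NONNEGATIVE
  set F : ℝ → ℂ := cutoffAt b θ with hF
  have hbsub : Icc (-b) b ⊆ Icc (-win.a) win.a := Icc_subset_Icc (by linarith) hba.le
  have hFsign : ∀ u, (F u).im = 0 ∧ 0 ≤ (F u).re := by
    intro u
    by_cases hu : u ∈ Icc (-b) b
    · have hFu : F u = ((profile (2 * win.a) v u : ℝ) : ℂ) := by
        simp only [hF, cutoffAt, indicator_of_mem hu, hθ, profileC]
      rw [hFu, Complex.ofReal_im, Complex.ofReal_re]
      exact ⟨rfl, hv u (hbsub hu)⟩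
    · have hFu : F u = 0 := by simp only [hF, cutoffAt, indicator_of_notMem hu]
      rw [hFu, Complex.zero_im, Complex.zero_re]
      exact ⟨rfl, le_rfl⟩
  have hFm : Measurable F := hθc.measurable.indicator measurableSet_Icc
  have hFi : Integrable F := integrable_cutoffAt hθc b
  have hFs : HasCompactSupport F :=
    HasCompactSupport.intro isCompact_Icc fun x hx ↦ indicator_of_notMem hx θ
  obtain ⟨M, hMb⟩ := isCompact_Icc.exists_bound_of_continuousOn (s := Icc (-b) b) hθc.continuousOn
  have hFC : ∀ x, ‖F x‖ ≤ max M 0 := by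
    intro x
    by_cases hx : x ∈ Icc (-b) b
    · simp only [hF, cutoffAt, indicator_of_mem hx]
      exact (hMb x hx).trans (le_max_left _ _)
    · simp only [hF, cutoffAt, indicator_of_notMem hx, norm_zero]
      exact le_max_right _ _
  have hFR : ∀ u : ℝ, b < |u| → F u = 0 := fun u hu ↦
    indicator_of_notMem (fun h ↦ by have := abs_le.2 ⟨h.1, h.2⟩; linarith) θ
  have hFev : ∀ x, F (-x) = F x := by
    intro x
    simp only [hF, cutoffAt]
    by_cases hx : x ∈ Icc (-b) b
    · have hnx : -x ∈ Icc (-b) b := ⟨by linarith [hx.2], by linarith [hx.1]⟩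
      rw [indicator_of_mem hx, indicator_of_mem hnx]
      simp only [hθ, profileC, CollarBound.profile_neg_arg]
    · have hnx : -x ∉ Icc (-b) b := fun h ↦ hx ⟨by linarith [h.2], by linarith [h.1]⟩
      rw [indicator_of_notMem hx, indicator_of_notMem hnx]
  have hAc : Continuous (autocorrAt b θ) := continuous_weilConv_weilReflect_cutoff hθc b
  have hAs : HasCompactSupport (autocorrAt b θ) := hasCompactSupport_weilConv_weilReflect_cutoff θ b
  have hAA := integrable_weilArchIntegrand_autocorrAt hθd hθ' hb0.le
  -- the two limits in `k`, and the support radius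
  have h3 : ∀ᶠ k : ℕ in atTop, dist (weilFunctional (weilConv (autocorrAt b θ) (mollSq k)))
      (weilFunctional (autocorrAt b θ)) < δ / 2 :=
    Metric.tendsto_nhds.1 (tendsto_weilFunctional_mollSq hAc hAs hAA) _ (by positivity)
  have h4 : ∀ᶠ k : ℕ in atTop, dist (weilConv (autocorrAt b θ) (mollSq k) 0) (autocorrAt b θ 0) <
      δ / 2 := Metric.tendsto_nhds.1 (tendsto_weilConv_mollSq hAc 0) _ (by positivity)
  have h5 : ∀ᶠ k : ℕ in atTop, (bump k).rOut < win.a - b := by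
    refine (Metric.tendsto_nhds.1 tendsto_bump_rOut (win.a - b) (by linarith)).mono fun k hk ↦ ?_
    rw [Real.dist_eq, sub_zero] at hk
    exact (abs_lt.1 hk).2
  obtain ⟨k, ⟨hk3, hk4⟩, hk5⟩ := ((h3.and h4).and h5).exists
  -- the test function `g = F_b ⋆ φ_k`
  refine ⟨weilConv F (moll k), isWeilTest_weilConv_moll_of_locallyIntegrable hFi.locallyIntegrable hFs k,
    (tsupport_weilConv_moll_subset hFR k).trans (Icc_subset_Icc (by linarith) (by linarith)),
    fun t ↦ weilConv_moll_neg hFev k t, fun t ↦ weilConv_moll_real_nonneg hFsign k t, ?_, ?_⟩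
  · -- mass
    have e1 : ((∫ t, ‖weilConv F (moll k) t‖ ^ 2 : ℝ) : ℂ) = weilConv (autocorrAt b θ) (mollSq k) 0 :=
      integral_norm_sq_weilConv_moll hFm hFi hFs hFC k
    have e2 : ((∫ t, ‖F t‖ ^ 2 : ℝ) : ℂ) = autocorrAt b θ 0 := (weilConv_weilReflect_apply_zero F).symm
    have d1 : |(∫ t, ‖weilConv F (moll k) t‖ ^ 2) - ∫ t, ‖F t‖ ^ 2| < δ / 2 := by
      have h := hk4
      rw [dist_eq_norm, ← e1, ← e2, ← Complex.ofReal_sub, Complex.norm_real, Real.norm_eq_abs] at h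
      exact h
    have d2 : |(∫ t, ‖F t‖ ^ 2) - ∫ t, ‖cutoffProfile win v t‖ ^ 2| < δ / 2 := by
      rw [hG]
      have h := hn2
      rwa [Real.dist_eq] at h
    calc |(∫ t, ‖weilConv F (moll k) t‖ ^ 2) - ∫ t, ‖cutoffProfile win v t‖ ^ 2|
        = |((∫ t, ‖weilConv F (moll k) t‖ ^ 2) - ∫ t, ‖F t‖ ^ 2) +
            ((∫ t, ‖F t‖ ^ 2) - ∫ t, ‖cutoffProfile win v t‖ ^ 2)| := by ring_nf
      _ ≤ |(∫ t, ‖weilConv F (moll k) t‖ ^ 2) - ∫ t, ‖F t‖ ^ 2| +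
            |(∫ t, ‖F t‖ ^ 2) - ∫ t, ‖cutoffProfile win v t‖ ^ 2| := abs_add_le _ _
      _ ≤ δ := by linarith
  · -- form
    have e3 : weilQuadratic (weilConv F (moll k)) =
        weilFunctional (weilConv (autocorrAt b θ) (mollSq k)) :=
      weilQuadratic_weilConv_moll hFm hFi hFs hFC k
    have e4 : weilQuadratic (cutoffProfile win v) = weilFunctional (autocorrAt win.a θ) := by
      rw [hG]; rfl
    have d3 : ‖weilQuadratic (weilConv F (moll k)) - weilFunctional (autocorrAt b θ)‖ < δ / 2 := by
      rw [e3, ← dist_eq_norm]; exact hk3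
    have d4 : ‖weilFunctional (autocorrAt b θ) - weilQuadratic (cutoffProfile win v)‖ < δ / 2 := by
      rw [e4, ← dist_eq_norm]; exact hn1
    calc |(weilQuadratic (weilConv F (moll k))).re - (weilQuadratic (cutoffProfile win v)).re|
        = |(weilQuadratic (weilConv F (moll k)) - weilQuadratic (cutoffProfile win v)).re| := by
          rw [Complex.sub_re]
      _ ≤ ‖weilQuadratic (weilConv F (moll k)) - weilQuadratic (cutoffProfile win v)‖ :=
          Complex.abs_re_le_norm _
      _ = ‖(weilQuadratic (weilConv F (moll k)) - weilFunctional (autocorrAt b θ)) +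
            (weilFunctional (autocorrAt b θ) - weilQuadratic (cutoffProfile win v))‖ := by
          congr 1; ring
      _ ≤ ‖weilQuadratic (weilConv F (moll k)) - weilFunctional (autocorrAt b θ)‖ +
            ‖weilFunctional (autocorrAt b θ) - weilQuadratic (cutoffProfile win v)‖ := norm_add_le _ _
      _ ≤ δ := by linarith

/-! ## §2 From a one-signed Galerkin bottom vector to a normalised nonnegative test near `ε₁^{(N)}(a)` -/

/-- PROVED: profiles are linear in the coefficient vector — scaling. [folklore] -/
theorem profile_const_smul (L c : ℝ) {N : ℕ} (u : Fin (N + 1) → ℝ) (x : ℝ) :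
    profile L (c • u) x = c * profile L u x := by
  simp only [profile, Pi.smul_apply, smul_eq_mul, Finset.mul_sum, mul_assoc]

/-- PROVED: at a window where `ζ`'s even block has a bottom vector with ONE-SIGNED profile there is a bottom
vector of unit Euclidean mass whose profile is NONNEGATIVE on `[-a, a]` (flip the sign, rescale). [folklore] -/
theorem exists_unit_nonneg_bottomVector_of_mem_oneSignedAt {a : ℝ} (ha : 0 < a) (N : ℕ)
    (hmem : zetaDatum ∈ oneSignedAt ⟨a, N, ha⟩) :
    ∃ w : Fin (N + 1) → ℝ, IsBottomVector (zetaDatum ⟨a, N, ha⟩) w ∧ w ⬝ᵥ w = 1 ∧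
      ∀ x ∈ Icc (-a) a, 0 ≤ profile (2 * a) w x := by
  -- a bottom vector with NONNEGATIVE profile
  obtain ⟨u, hu, hnn⟩ : ∃ u : Fin (N + 1) → ℝ, IsBottomVector (zetaDatum ⟨a, N, ha⟩) u ∧
      ∀ x ∈ Icc (-a) a, 0 ≤ profile (2 * a) u x := by
    obtain ⟨u, hu, hsgn⟩ := hmem
    have hL : 2 * a / 2 = a := by ring
    simp only [OneSigned, hL] at hsgn
    rcases hsgn with hpos | hneg
    · exact ⟨u, hu, hpos⟩
    · refine ⟨-u, ⟨neg_ne_zero.2 hu.1, by rw [Matrix.mulVec_neg, hu.2, smul_neg]⟩, fun x hx => ?_⟩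
      rw [CentralMassFloor.profile_neg]
      exact neg_nonneg.2 (hneg x hx)
  -- rescale to unit mass
  have hm : 0 < u ⬝ᵥ u :=
    lt_of_le_of_ne (dotProduct_self_nonneg_real u) fun h0 ↦ hu.1 (dotProduct_self_eq_zero.1 h0.symm)
  set c : ℝ := (Real.sqrt (u ⬝ᵥ u))⁻¹ with hc
  have hcpos : 0 < c := inv_pos.2 (Real.sqrt_pos.2 hm)
  have hc2 : c * c = (u ⬝ᵥ u)⁻¹ := by rw [hc, ← mul_inv, Real.mul_self_sqrt hm.le]
  refine ⟨c • u, ⟨smul_ne_zero hcpos.ne' hu.1, by rw [Matrix.mulVec_smul, hu.2, smul_comm]⟩, ?_, fun x hx => ?_⟩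
  · rw [smul_dotProduct, dotProduct_smul, smul_eq_mul, smul_eq_mul, ← mul_assoc, hc2, inv_mul_cancel₀ hm.ne']
  · rw [profile_const_smul]
    exact mul_nonneg hcpos.le (hnn x hx)

/-- **PROVED — at a ONE-SIGNED truncation there are nonnegative even tests `δ`-close to the bottom:** if
`zetaDatum ∈ oneSignedAt ⟨a, N, ha⟩` then for every `δ > 0` some smooth even test `g` in `[-a, a]`, real and
nonnegative pointwise, has `|∫|g|² − 1| ≤ δ` and `|Re Q(g) − ε₁^{(N)}(a)| ≤ δ`. Uses the window-matrix
identity `galerkinMatrixIdentity` (GAL-0 (i)) at the unit nonnegative bottom vector. [folklore] -/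
theorem exists_nonneg_test_of_mem_oneSignedAt {a : ℝ} (ha : 0 < a) (N : ℕ)
    (hmem : zetaDatum ∈ oneSignedAt ⟨a, N, ha⟩) {δ : ℝ} (hδ : 0 < δ) :
    ∃ g : ℝ → ℂ, IsWeilTest g ∧ tsupport g ⊆ Icc (-a) a ∧ (∀ t, g (-t) = g t) ∧
      (∀ t, (g t).im = 0 ∧ 0 ≤ (g t).re) ∧ |(∫ t, ‖g t‖ ^ 2) - 1| ≤ δ ∧
      |(weilQuadratic g).re - bottomRayleigh (zetaDatum ⟨a, N, ha⟩)| ≤ δ := by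
  obtain ⟨w, hw, hw1, hnn⟩ := exists_unit_nonneg_bottomVector_of_mem_oneSignedAt ha N hmem
  obtain ⟨g, hg, hs, hev, hsign, hmass, hQ⟩ := exists_nonneg_test_near_cutoffProfile ⟨a, N, ha⟩ w hnn hδ
  obtain ⟨hform, hnorm⟩ := galerkinMatrixIdentity ⟨a, N, ha⟩ w
  have hbot : w ⬝ᵥ (zetaDatum ⟨a, N, ha⟩ *ᵥ w) = bottomRayleigh (zetaDatum ⟨a, N, ha⟩) := by
    rw [hw.2, dotProduct_smul, smul_eq_mul, hw1, mul_one]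
  refine ⟨g, hg, hs, hev, hsign, ?_, ?_⟩
  · rwa [← hnorm, hw1] at hmass
  · rwa [← hform, hbot] at hQ

/-- **PROVED — `L²`-NORMALISATION keeps evenness, support and sign, and divides `Re Q` by the mass.** [folklore] -/
theorem exists_normalised_of_nonneg_test {a : ℝ} {g : ℝ → ℂ} (hg : IsWeilTest g)
    (hs : tsupport g ⊆ Icc (-a) a) (hev : ∀ t, g (-t) = g t) (hsign : ∀ t, (g t).im = 0 ∧ 0 ≤ (g t).re)
    (hm : 0 < ∫ t, ‖g t‖ ^ 2) :
    ∃ h : ℝ → ℂ, IsWeilTest h ∧ tsupport h ⊆ Icc (-a) a ∧ (∀ t, h (-t) = h t) ∧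
      (∀ t, (h t).im = 0 ∧ 0 ≤ (h t).re) ∧ ∫ t, ‖h t‖ ^ 2 = 1 ∧
      (weilQuadratic h).re = (weilQuadratic g).re / ∫ t, ‖g t‖ ^ 2 := by
  set m : ℝ := ∫ t, ‖g t‖ ^ 2 with hm_def
  set c : ℝ := (Real.sqrt m)⁻¹ with hc
  have hcpos : 0 < c := inv_pos.2 (Real.sqrt_pos.2 hm)
  have hc2 : c * c = m⁻¹ := by rw [hc, ← mul_inv, Real.mul_self_sqrt hm.le]
  refine ⟨fun t ↦ (c : ℂ) * g t, hg.const_mul c, tsupport_mul_subset_right.trans hs,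
    fun t ↦ by simp only [hev t], fun t ↦ ⟨?_, ?_⟩, ?_, ?_⟩
  · rw [Complex.im_ofReal_mul, (hsign t).1, mul_zero]
  · rw [Complex.re_ofReal_mul]
    exact mul_nonneg hcpos.le (hsign t).2
  · simp only [norm_mul, mul_pow, Complex.norm_real, Real.norm_of_nonneg hcpos.le]
    rw [integral_const_mul, ← hm_def, sq, hc2, inv_mul_cancel₀ hm.ne']
  · rw [weilQuadratic_const_mul, Complex.normSq_ofReal, Complex.re_ofReal_mul, hc2, div_eq_inv_mul]

/-! ## §3 GAL-2: the limit is a one-signed continuum even ground state -/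

/-- PROVED: `1/(n+2) → 0`. [folklore] -/
theorem tendsto_one_div_add_two : Tendsto (fun n : ℕ ↦ (1 : ℝ) / ((n : ℝ) + 2)) atTop (𝓝 0) := by
  have h0 : Tendsto (fun n : ℕ ↦ 1 / ((n : ℝ) + 1)) atTop (𝓝 0) := tendsto_one_div_add_atTop_nhds_zero_nat
  refine (h0.comp (tendsto_add_atTop_nat 1)).congr fun n ↦ ?_
  simp only [Function.comp_apply, Nat.cast_add, Nat.cast_one]
  ring_nf

/-- **PROVED — GAL-2 (eigenvector half): ONE-SIGNED GALERKIN BOTTOM VECTORS AT INFINITELY MANY TRUNCATIONS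
GIVE A ONE-SIGNED CONTINUUM EVEN GROUND STATE.** For `a > 0`: if `zetaDatum ∈ oneSignedAt ⟨a, N, ha⟩` for
infinitely many `N`, then some `u` with `IsWeilEvenGroundState a u` is real and nonnegative a.e. on
`(-a, a)`. RH-free; no simplicity hypothesis; proof in the module docstring. [folklore] -/
theorem exists_oneSigned_evenGroundState_of_frequently_oneSignedAt {a : ℝ} (ha : 0 < a)
    (h : ∃ᶠ N in atTop, zetaDatum ∈ oneSignedAt ⟨a, N, ha⟩) :
    ∃ u : ℝ → ℂ, IsWeilEvenGroundState a u ∧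
      ∀ᵐ t : ℝ, t ∈ Ioo (-a) a → (u t).im = 0 ∧ 0 ≤ (u t).re := by
  obtain ⟨φ, hφ, hφS⟩ := extraction_of_frequently_atTop h
  have hδ : ∀ n : ℕ, (0 : ℝ) < 1 / ((n : ℝ) + 2) := fun n ↦ by positivity
  -- (2) nonnegative even tests near the bottom of each one-signed truncation
  choose g hg hs hev hsign hmass hQ using fun n ↦ exists_nonneg_test_of_mem_oneSignedAt ha (φ n) (hφS n) (hδ n)
  have hmpos : ∀ n, 0 < ∫ t, ‖g n t‖ ^ 2 := fun n ↦ by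
    have h1 := (abs_le.1 (hmass n)).1
    have h2 : 1 / ((n : ℝ) + 2) ≤ 1 / 2 :=
      div_le_div_of_nonneg_left zero_le_one (by norm_num) (by linarith [n.cast_nonneg (α := ℝ)])
    linarith
  choose hh hht hhs hhev hhsign hhmass hhQ using fun n ↦
    exists_normalised_of_nonneg_test (hg n) (hs n) (hev n) (hsign n) (hmpos n)
  -- (3) the normalised tests form an even MINIMISING sequence: `Re Q(h_n) → ε_ev(a)`
  have hm1 : Tendsto (fun n ↦ ∫ t, ‖g n t‖ ^ 2) atTop (𝓝 1) := by
    have h0 : Tendsto (fun n ↦ (∫ t, ‖g n t‖ ^ 2) - 1) atTop (𝓝 0) :=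
      squeeze_zero_norm (fun n ↦ by rw [Real.norm_eq_abs]; exact hmass n) tendsto_one_div_add_two
    simpa using h0.add_const 1
  have hq : Tendsto (fun n ↦ (weilQuadratic (g n)).re) atTop (𝓝 (weilEvenGroundEnergy a)) := by
    have hb := tendsto_bottomRayleigh_comp_strictMono ha hφ
    have h0 : Tendsto (fun n ↦ (weilQuadratic (g n)).re - bottomRayleigh (zetaDatum ⟨a, φ n, ha⟩))
        atTop (𝓝 0) :=
      squeeze_zero_norm (fun n ↦ by rw [Real.norm_eq_abs]; exact hQ n) tendsto_one_div_add_two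
    simpa using h0.add hb
  have hQh : Tendsto (fun n ↦ (weilQuadratic (hh n)).re) atTop (𝓝 (weilEvenGroundEnergy a)) := by
    have hdiv := hq.div hm1 one_ne_zero
    rw [div_one] at hdiv
    exact hdiv.congr fun n ↦ (hhQ n).symm
  -- compactness (CCM25 Thm 3.6, PROVED) and the sign of the limit
  obtain ⟨u, hu, ψ, hψ, hconv⟩ := ConnesConsaniMoscovici2025_thm_3_6_holds a ha hh
    (fun n ↦ ⟨hht n, hhs n, hhmass n⟩) hQh.bddAbove_range
  refine ⟨u, IsWeilEvenGroundState.of_tendsto hu (fun n ↦ ⟨hht (ψ n), hhs (ψ n), hhev (ψ n), hhmass (ψ n)⟩)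
    (hQh.comp hψ.tendsto_atTop) hconv, ?_⟩
  have hae := PolarPerronFrobenius.stub_aeNonneg_of_L2_limit (fun n ↦ hh (ψ n)) u
    (fun n ↦ (hht (ψ n)).memLp_two) hu (fun n t ↦ hhsign (ψ n) t) hconv
  exact hae.mono fun t ht _ ↦ ht

/-- PROVED (eventually-version): one-signed bottom vectors at ALL sufficiently large truncations suffice. [folklore] -/
theorem exists_oneSigned_evenGroundState_of_eventually_oneSignedAt {a : ℝ} (ha : 0 < a)
    (h : ∀ᶠ N in atTop, zetaDatum ∈ oneSignedAt ⟨a, N, ha⟩) :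
    ∃ u : ℝ → ℂ, IsWeilEvenGroundState a u ∧
      ∀ᵐ t : ℝ, t ∈ Ioo (-a) a → (u t).im = 0 ∧ 0 ≤ (u t).re :=
  exists_oneSigned_evenGroundState_of_frequently_oneSignedAt ha h.frequently

/-- **PROVED (RH-free implication) — COFINAL one-signed truncation ladders give `EvenOneSignedWindows`:** if
beyond every height `A` there is a half-length `a ≥ A` at which `ζ`'s even blocks have one-signed bottom
vectors for infinitely many truncations, then the crux `EvenOneSignedWindows` of `EvenSectorBarta` holds.
The hypothesis is a law over unboundedly many half-lengths — no finite served table asserts it. [folklore] -/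
theorem evenOneSignedWindows_of_cofinal_frequently_oneSignedAt
    (h : ∀ A : ℝ, ∃ a : ℝ, A ≤ a ∧ ∃ ha : 0 < a, ∃ᶠ N in atTop, zetaDatum ∈ oneSignedAt ⟨a, N, ha⟩) :
    Summit.RiemannHypothesis.RiemannHypothesis.Theses.EvenSectorBarta.EvenOneSignedWindows := by
  refine PolarPerronFrobenius.evenOneSignedWindows_iff_cofinal.2 fun A ↦ ?_
  obtain ⟨a, hAa, ha, hfr⟩ := h A
  exact ⟨a, hAa, exists_oneSigned_evenGroundState_of_frequently_oneSignedAt ha hfr⟩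

/-- **PROVED, CONDITIONAL [E1] (RH-strength hypothesis; credits nothing, no RH claim):** cofinal one-signed
truncation ladders of `ζ`'s even blocks imply RH, through `EvenOneSignedWindows` and the landed
`PolarPerronFrobenius.riemannHypothesis_of_evenOneSignedWindows` (Barta / ground-state positivity chain).
This is the cell's G1.IMP "M1_fin ⇒ T1 ⇒ RH" as ONE tree implication; its hypothesis is a `ζ`-law over all
half-lengths that no finite computation discharges. [folklore] -/
theorem riemannHypothesis_of_cofinal_frequently_oneSignedAt
    (h : ∀ A : ℝ, ∃ a : ℝ, A ≤ a ∧ ∃ ha : 0 < a, ∃ᶠ N in atTop, zetaDatum ∈ oneSignedAt ⟨a, N, ha⟩) :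
    RiemannHypothesis :=
  PolarPerronFrobenius.riemannHypothesis_of_evenOneSignedWindows
    (evenOneSignedWindows_of_cofinal_frequently_oneSignedAt h)

end Summit.RiemannHypothesis.RiemannHypothesis.Theorems.PfPersistence
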